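import Summits.NavierStokesRegularity.NavierStokesRegularity.Theorems.NoOverheating.Negative.DefectGauge
import Summits.NavierStokesRegularity.NavierStokesRegularity.Theorems.RungBlowupCofinal.Negative.ForwardStubParasitic
import HarnessLib

/-!
# The pressure gauge of a rung profile, complement: every constant force is an admissible rung-`0`
# defect, and divergence-freeness of the force alone does not gate the defect-decay stub
# (route `AngularGalerkinLadder`, K2 `NoOverheating`)

Negative-lane complement to `Theorems/NoOverheating/Negative/DefectGauge.lean` (refuter5, K5-45) for
`stmt-NavierStokesRegularity-19960`, cell ns-blowup, refuter4 (g5, K106), filed at the planner's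
invitation (plan g21, 2026-08-27T02:37Z: «`isCobandLimited_zero_const` for arbitrary constants … welcome
as a SECOND file with distinct FQNs»). No route file is imported; nothing here asserts a Theses
declaration. WHAT THIS IS NOT: not Navier–Stokes evidence and not a verdict on the item.

* `isCobandLimited_zero_const` — EVERY constant field `c` (not only those of the form `e_a × c`) is
  co-band-limited of degree `0`: constants are the degree-one vector isotype, `𝒞 c = 2c`
  (`casimir_const`, refuter g14's KJ-18 kit), so `c = 𝒞(c/2)` is a Casimir image and
  `isCobandLimited_zero_casimir` (lean g11's adjointness kit) applies — three lines, no test-field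
  integration.
* `isRungProfile_restGauge_const` — hence the rest state `u ≡ 0` with pressure `⟪e, x⟫` and force
  `d ≡ e` is a Type-I rotated-DSS ancient rung-`0` profile for EVERY vector `e`, factor `c > 1`,
  rotation `R`.
* `stub_defect_decay_false_of_divFree_gate` — adding to the v3 stub the hypothesis that every force
  slice is divergence-free (`∀ t < 0, div d(t) = 0`, the first clause of v4's physical gauge
  `InPhysicalGauge M d`) does NOT rescue it: constant forces are divergence-free (inline; the named fact is the tree's
  `SymmetricLiouville.Negative.isDivFree_fun_const`). So of the two clauses
  of the physical gauge it is the scale-invariant envelope `HasDefectBound M d` that excludes the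
  rest-gauge family (it is exactly what fails, `not_hasDefectBound_const`); the planner's docstring
  argument («`u ≡ 0` forces `d = ∇p` curl-free, div-free and `O(‖x‖⁻³)`, hence `0`») uses both.

[folklore]
-/

noncomputable section

namespace Summit.NavierStokesRegularity.NoOverheatingDefectGaugeDivFree

open Set MeasureTheory Filter Topology Function
open scoped ContDiff RealInnerProductSpace
open Literature.Analysis.FluidPDE
open Summit.NavierStokesRegularity.FluidComputer
open Summit.NavierStokesRegularity.FluidComputer.AngularLadder
open Summit.NavierStokesRegularity.NoOverheatingDefectGauge
open Summit.NavierStokesRegularity.RungBlowupCofinalForwardStubParasitic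

/-- **Every constant field is co-band-limited of degree `0`** (`c = 𝒞(c/2)` is a Casimir image).
[folklore] -/
theorem isCobandLimited_zero_const (c : EuclideanSpace ℝ (Fin 3)) :
    IsCobandLimited 0 (fun _ : EuclideanSpace ℝ (Fin 3) => c) := by
  have hv : ContDiff ℝ ∞ (fun _ : EuclideanSpace ℝ (Fin 3) => (1 / 2 : ℝ) • c) := contDiff_const
  have h := isCobandLimited_zero_casimir hv
  rw [casimir_const] at h
  have e : (fun _ : EuclideanSpace ℝ (Fin 3) => (2 : ℝ) • (1 / 2 : ℝ) • c) = fun _ => c := by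
    funext x
    rw [smul_smul]
    norm_num
  rwa [e] at h

/-- The rest state with the linear pressure `⟪e, x⟫` and the constant force `e` is a classical solution
of the forced system on any time set, for any viscosity and ANY vector `e` (`0 + 0 = 0 − e + e`).
[folklore] -/
theorem isClassicalNSSolutionOn_restGauge_const (S : Set ℝ) (ν : ℝ) (e : EuclideanSpace ℝ (Fin 3)) :
    IsClassicalNSSolutionOn S ν (fun _ _ => e : ℝ → EuclideanSpace ℝ (Fin 3) → EuclideanSpace ℝ (Fin 3))
      (0 : ℝ → EuclideanSpace ℝ (Fin 3) → EuclideanSpace ℝ (Fin 3))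
      (fun _ x => ⟪e, x⟫ : ℝ → EuclideanSpace ℝ (Fin 3) → ℝ) where
  smooth_velocity := contDiffOn_const
  smooth_pressure := by
    have : ContDiff ℝ ∞ (uncurry (fun _ x => ⟪e, x⟫ : ℝ → EuclideanSpace ℝ (Fin 3) → ℝ)) := by
      change ContDiff ℝ ∞ fun q : ℝ × EuclideanSpace ℝ (Fin 3) => ⟪e, q.2⟫
      exact (innerSL ℝ e).contDiff.comp contDiff_snd
    exact this.contDiffOn
  momentum t _ x := by
    simp [convect, Pi.zero_def, gradient_inner_const]
  divFree t _ := by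
    simp only [VectorCalculus.IsDivFree, VectorCalculus.divergence]
    intro x
    simp [Pi.zero_def]

/-- **The rest state in ANY constant gauge is a Type-I rotated-DSS ancient rung-`0` profile** (Type-I
constant `0`, every factor `c > 1`, every rotation `R`, every force vector `e`). [folklore] -/
theorem isRungProfile_restGauge_const {c : ℝ} (hc : 1 < c)
    (R : EuclideanSpace ℝ (Fin 3) ≃ₗᵢ[ℝ] EuclideanSpace ℝ (Fin 3)) (e : EuclideanSpace ℝ (Fin 3)) :
    IsRungProfile 0 0 c R (0 : ℝ → EuclideanSpace ℝ (Fin 3) → EuclideanSpace ℝ (Fin 3))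
      (fun _ x => ⟪e, x⟫) (fun _ _ => e) := by
  refine ⟨⟨isClassicalNSSolutionOn_restGauge_const _ _ e, fun t _ => isBandLimited_zero_field 0,
    fun t _ => isCobandLimited_zero_const e⟩, hc, ?_, ?_⟩
  · intro t x
    simp
  · intro t _ x
    simp

/-- **Gating the v3 stub by divergence-freeness of the force alone does not rescue it**: the v3 body
of `stub_defect_decay` with the extra hypothesis `∀ t < 0, div d(t) = 0` (and without the irrelevant
clause `ε → 0`) is still false — instance `C₀ = 0`, `c_min = c_max = 2`, `L = 0`, rest state in the
constant gauge `e₂`, which is divergence-free. [folklore] -/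
theorem stub_defect_decay_false_of_divFree_gate :
    ¬ (∀ C₀ cmin cmax : ℝ, ∃ ε : ℕ → ℝ,
      ∀ (L : ℕ) (c : ℝ) (R : EuclideanSpace ℝ (Fin 3) ≃ₗᵢ[ℝ] EuclideanSpace ℝ (Fin 3))
        (u : ℝ → EuclideanSpace ℝ (Fin 3) → EuclideanSpace ℝ (Fin 3))
        (p : ℝ → EuclideanSpace ℝ (Fin 3) → ℝ)
        (d : ℝ → EuclideanSpace ℝ (Fin 3) → EuclideanSpace ℝ (Fin 3)),
        IsRungProfile L C₀ c R u p d → cmin ≤ c → c ≤ cmax →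
          (∀ t < 0, VectorCalculus.IsDivFree (d t)) → HasDefectBound (ε L) d) := by
  intro h
  obtain ⟨ε, hε⟩ := h 0 2 2
  exact not_hasDefectBound_axis_two (ε 0)
    (hε 0 2 (LinearIsometryEquiv.refl ℝ _) 0 (fun _ x => ⟪axis 2, x⟫) (fun _ _ => axis 2)
      (isRungProfile_restGauge_const (by norm_num) _ _) le_rfl le_rfl fun _ _ x => by
        -- a constant field is divergence-free (tree: `SymmetricLiouville.Negative.isDivFree_fun_const`,
        -- not imported to keep this file free of other routes' Theses)
        simp [VectorCalculus.divergence])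

/-- The same with the registered decay clause kept (verbatim v3 body plus the divergence gate).
[folklore] -/
theorem stub_defect_decay_false_of_divFree_gate' :
    ¬ (∀ C₀ cmin cmax : ℝ, ∃ ε : ℕ → ℝ, Tendsto ε atTop (𝓝 0) ∧
      ∀ (L : ℕ) (c : ℝ) (R : EuclideanSpace ℝ (Fin 3) ≃ₗᵢ[ℝ] EuclideanSpace ℝ (Fin 3))
        (u : ℝ → EuclideanSpace ℝ (Fin 3) → EuclideanSpace ℝ (Fin 3))
        (p : ℝ → EuclideanSpace ℝ (Fin 3) → ℝ)
        (d : ℝ → EuclideanSpace ℝ (Fin 3) → EuclideanSpace ℝ (Fin 3)),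
        IsRungProfile L C₀ c R u p d → cmin ≤ c → c ≤ cmax →
          (∀ t < 0, VectorCalculus.IsDivFree (d t)) → HasDefectBound (ε L) d) := by
  intro h
  refine stub_defect_decay_false_of_divFree_gate fun C₀ cmin cmax => ?_
  obtain ⟨ε, -, hε⟩ := h C₀ cmin cmax
  exact ⟨ε, hε⟩

end Summit.NavierStokesRegularity.NoOverheatingDefectGaugeDivFree

end
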